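import Literature.NumberTheory.Rogawski1990.FinExplicitTransferFactor
import Literature.NumberTheory.Rogawski1990.LocalTransferExistence
import HarnessLib

/-!
# `Δ‴_v ≠ 0` on the matching `G`-regular pairs: Rogawski's explicit FINITE-place transfer factor is NON-DEGENERATE
# (node N2f of `F0/P3a/T6b-TREE.md` §9; desk table #3 row (3) of the P3a bus, 2026-08-31)

Topic `NumberTheory/Rogawski1990`; namespace `Literature.NumberTheory.Rogawski1990`.  THEOREMS ONLY (no `def` ∕ fact ∕ `sorry` ∕ instance ∕ notation);
imports ★ `FinExplicitTransferFactor` (typ-T6b, p827456) and ★ `LocalTransferExistence` (`IsLocalNondegenerate`).  Cell `pub/hodgecm-mathlib`, F0∕P3a, topic T6, seat B-p12 (g25); the finite-place twin of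
★ `ArchExplicitTransferFactorRegular` ∕ ★ `ArchExplicitTransferFactorNondegenerate` (N2∞).  HONEST LABEL: HC_CM is proved only modulo the printed citations
(«named inputs remaining 2») until rung 0 closes; this file proves nothing of them — it discharges the `IsLocalNondegenerate` clause of the #72 letter ★
`GlobalTransferWithCartanKappaFormula` AT PRINT'S FINITE FACTORS `Δ‴_v` (★ `finExplicitTransferFactor L v H′ μ hl hr`, the member at `v` of ★
`finExplicitCollection`), with NO hypothesis on `H′` or `μ`.

THE MATHEMATICS (Rogawski 1990 §4.9 pp. 54–55, local field `F = L⁺_v`, `E = ∏_{w∣v} L_w`): on a matching pair `ι_v(γ_H) ↔ γ′`, `γ_H = (g, u)` `G`-regular,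
`Δ‴_v = τ_v(γ_H) · D_{G∕H,v}(γ_H) · κ_v(γ_H, γ′)` (★ `finExplicitDelta_of_isLocalNormPair`) and each factor is non-zero:
* REGULARITY UNPACKED: `IsLocalGRegular` = separability of `charpoly ι_v(γ_H) = χ_g · (X − u)` over `E` (★ `coe_endoGL`, Mathlib `charpoly_reindex`,
  `charpoly_fromBlocks_zero₁₂`), pushed to each factor `L_w` of `E` (a field): squarefree there, so `χ_g(u)_w ≠ 0` for every `w ∣ v`, i.e. **`χ_g(u)` is a unit of
  `E`** (`isUnit_eval_finCharpolyTwo_of_isLocalGRegular`).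
* `τ_v ≠ 0`: `u = det` of an element of `GL₁(E)` and `−χ_g(u)·det g⁻¹` are units, and ★ `finHeckeValue μ` of a unit is a value of the semi-local component in
  `ℂˣ`.  `D_{G∕H,v} = (Π_{w∣v} ‖χ_g(u)_w‖_w)^{1∕2} > 0`.
* `κ_v ≠ 0`: ★ `finKappaAt` is `±1` as soon as `P_v = χ_g(γ′) ≠ 0`, and on a matching pair `P_v = c · χ_g(u)E₂₂ · c⁻¹` (`γ′ = c ι_v(γ_H) c⁻¹` by ★ `Corresponds`;
  Cayley–Hamilton on the `g`-block of the pattern — the algebra of ★ `archEigenlineProjector_eq_vecMulVec_of_isArchNormPair` over the ring `E`), so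
  `tr P_v = χ_g(u)` is a unit, hence `P_v ≠ 0` (`trace_finEigenlineProjector_of_isLocalNormPair`, `finEigenlineProjector_ne_zero`).
* assembly: `isLocalNondegenerate_finExplicitTransferFactor`, and for the collection `isLocalNondegenerate_finExplicitCollection`.

## References
* [Rogawski1990] J. D. Rogawski, *Automorphic Representations of Unitary Groups in Three Variables*, Ann. of Math. Stud. 123 (1990): §4.3 p. 42
  (`G`-regular), §4.9 pp. 54–55 (`τ`, `D_{G∕H}`, `|Δ_{G∕H}| = D_{G∕H}`), §14.6 p. 242 (`κ = ±1`).
* [LanglandsShelstad1987] R. P. Langlands, D. Shelstad, *On the definition of transfer factors*, Math. Ann. 278 (1987), §1 (`G`-regular pairs).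
-/

set_option autoImplicit false

noncomputable section

open NumberField IsDedekindDomain Matrix Polynomial
open Literature.NumberTheory.GaloisRepresentations
open scoped MatrixGroups

namespace Literature.NumberTheory.Rogawski1990

open Literature.NumberTheory.Automorphic

/-! ## §1 Matrix algebra over a commutative ring (private plumbing; the ring is `E = ∏_{w∣v} L_w`, not a field) -/

section Algebra

variable {R : Type*} [CommRing R]

/-- **Cayley–Hamilton on the `g`-block of the pattern `ι(g, u) = (g₀₀ 0 g₀₁; 0 u 0; g₁₀ 0 g₁₁)`**:
`ι² − tr(g)·ι + det(g)·1 = (u² − tr(g)u + det g) · E₂₂`. [folklore] -/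
private theorem endoPattern_sq_sub_trace_smul_add_det_smul_one (g : Matrix (Fin 2) (Fin 2) R) (u : R) :
    (!![g 0 0, 0, g 0 1; 0, u, 0; g 1 0, 0, g 1 1] * !![g 0 0, 0, g 0 1; 0, u, 0; g 1 0, 0, g 1 1] -
        g.trace • !![g 0 0, 0, g 0 1; 0, u, 0; g 1 0, 0, g 1 1] + g.det • (1 : Matrix (Fin 3) (Fin 3) R)) =
      vecMulVec (Pi.single 1 (u * u - g.trace * u + g.det)) (Pi.single 1 1) := by
  ext i j
  rw [Matrix.trace_fin_two, Matrix.det_fin_two]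
  fin_cases i <;> fin_cases j <;>
    simp [vecMulVec_apply] <;> ring

/-- Conjugating a quadratic polynomial in a matrix: `(cιc′)² − t·(cιc′) + d = c (ι² − tι + d) c′` when `c′c = 1 = cc′`. [folklore] -/
private theorem conj_mul_sq_sub_smul_add_smul_one {m : Type*} [Fintype m] [DecidableEq m] (c c' ι : Matrix m m R) (t d : R)
    (h1 : c' * c = 1) (h2 : c * c' = 1) :
    c * ι * c' * (c * ι * c') - t • (c * ι * c') + d • (1 : Matrix m m R) = c * (ι * ι - t • ι + d • 1) * c' := by
  have hsq : c * ι * c' * (c * ι * c') = c * (ι * ι) * c' := by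
    calc c * ι * c' * (c * ι * c') = c * ι * (c' * c) * ι * c' := by simp only [Matrix.mul_assoc]
      _ = c * (ι * ι) * c' := by rw [h1, Matrix.mul_one, Matrix.mul_assoc c ι ι]
  rw [hsq]
  simp only [Matrix.mul_sub, Matrix.mul_add, Matrix.sub_mul, Matrix.add_mul, Matrix.mul_smul, Matrix.smul_mul, Matrix.mul_one, h2]

/-- `tr(c M c′) = tr M` when `c′c = 1`. [folklore] -/
private theorem trace_conj_eq {m : Type*} [Fintype m] [DecidableEq m] (c c' M : Matrix m m R) (h1 : c' * c = 1) :
    (c * M * c').trace = M.trace := by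
  rw [Matrix.trace_mul_cycle, h1, Matrix.one_mul]

end Algebra

/-! ## §2 `G`-regularity at `v`: `χ_g(u)` is a unit of `E = ∏_{w∣v} L_w`; `τ_v ≠ 0`, `D_{G∕H,v} ≠ 0` -/

section Place

variable (L : Type) [Field L] [NumberField L] [IsCMField L] (v : HeightOneSpectrum (𝓞 ↥(maximalRealSubfield L)))
  (H' : Matrix (Fin 3) (Fin 3) L)
  (a : (UnitaryGroup.cmDatum L 2 (Matrix.of fun i j : Fin 2 => if i.val + j.val + 1 = 2 then (1 : L) else 0)).Local v ×
      (UnitaryGroup.cmDatum L 1 (Matrix.of fun i j : Fin 1 => if i.val + j.val + 1 = 1 then (1 : L) else 0)).Local v)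
  (b : (UnitaryGroup.cmDatum L 3 H').Local v)

omit [IsCMField L] in
/-- `E = ∏_{w∣v} L_w` is non-trivial (there is a place above `v`). [folklore] -/
private theorem nontrivial_localRing : Nontrivial (UnitaryGroup.LocalRing L v) := by
  obtain ⟨w⟩ := (inferInstance : Nonempty (UnitaryGroup.PlacesOver L v))
  exact ⟨⟨0, 1, fun h => zero_ne_one (congrFun h w)⟩⟩

/-- **Regularity unpacked at `v`: `χ_g(u)` is a unit of `E = ∏_{w∣v} L_w`** — at each `w ∣ v` the characteristic polynomial of `ι_v(γ_H)_w = g_w ⊕ u_w` is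
`χ_{g_w}·(X − u_w)`, separable (hence squarefree) when `γ_H` is `G`-regular, so `χ_{g_w}(u_w) ≠ 0` in the field `L_w`. [cite: Rogawski1990, §4.3 p. 42; §4.9 p. 55] -/
theorem isUnit_eval_finCharpolyTwo_of_isLocalGRegular (hreg : IsLocalGRegular L v a) :
    IsUnit ((finCharpolyTwo L v a).eval (finGammaTwo L v a)) := by
  set g := (a.1.val.val : Matrix (Fin 2) (Fin 2) (UnitaryGroup.LocalRing L v)) with hg
  set U := (a.2.val.val : Matrix (Fin 1) (Fin 1) (UnitaryGroup.LocalRing L v)) with hU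
  have hsep : (g.charpoly * U.charpoly).Separable := by
    have h1 := hreg
    simp only [IsLocalGRegular, IsGRegular, IsRegularElt, coe_endoEmb, coe_endoGL, Matrix.charpoly_reindex,
      Matrix.charpoly_fromBlocks_zero₁₂] at h1
    exact h1
  rw [Pi.isUnit_iff]
  intro w
  rw [isUnit_iff_ne_zero]
  set φ : UnitaryGroup.LocalRing L v →+* w.1.adicCompletion L :=
    Pi.evalRingHom (fun w : UnitaryGroup.PlacesOver L v => w.1.adicCompletion L) w with hφ
  have hsepw := hsep.map (f := φ)
  rw [Polynomial.map_mul, ← Matrix.charpoly_map, ← Matrix.charpoly_map] at hsepw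
  have hUc : (U.map φ).charpoly = X - C (φ (U 0 0)) := by
    rw [Matrix.charpoly, Matrix.det_fin_one, Matrix.charmatrix_apply_eq, Matrix.map_apply]
  rw [hUc] at hsepw
  have hev : ((finCharpolyTwo L v a).eval (finGammaTwo L v a)) w = ((g.map φ).charpoly).eval (φ (U 0 0)) := by
    have e : ((finCharpolyTwo L v a).eval (finGammaTwo L v a)) w = φ ((finCharpolyTwo L v a).eval (finGammaTwo L v a)) := rfl
    rw [e, ← Polynomial.eval₂_at_apply, ← Polynomial.eval_map, finCharpolyTwo, ← Matrix.charpoly_map]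
    rfl
  intro h0
  rw [hev] at h0
  have hdvd : (X - C (φ (U 0 0))) * (X - C (φ (U 0 0))) ∣ (g.map φ).charpoly * (X - C (φ (U 0 0))) :=
    mul_dvd_mul_right (dvd_iff_isRoot.2 h0) _
  exact not_isUnit_X_sub_C (φ (U 0 0)) (hsepw.squarefree _ hdvd)

/-- **`χ_g(u)` expanded**: `χ_g(u) = u² − tr(g) u + det(g)` in `E` (Mathlib `charpoly_fin_two`). [cite: Rogawski1990, §4.9 p. 55] -/
theorem eval_finCharpolyTwo_finGammaTwo :
    (finCharpolyTwo L v a).eval (finGammaTwo L v a) =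
      finGammaTwo L v a * finGammaTwo L v a - (a.1.val.val : Matrix (Fin 2) (Fin 2) (UnitaryGroup.LocalRing L v)).trace * finGammaTwo L v a +
        (a.1.val.val : Matrix (Fin 2) (Fin 2) (UnitaryGroup.LocalRing L v)).det := by
  haveI := nontrivial_localRing L v
  rw [finCharpolyTwo, Matrix.charpoly_fin_two]
  simp only [eval_add, eval_sub, eval_mul, eval_pow, eval_X, eval_C]
  ring

/-- **`u` is a unit** (the determinant of an element of `GL₁(E)`). [cite: Rogawski1990, §4.9 p. 55] -/
theorem isUnit_finGammaTwo : IsUnit (finGammaTwo L v a) := by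
  unfold finGammaTwo
  rw [← Matrix.det_fin_one (a.2.val.val : Matrix (Fin 1) (Fin 1) (UnitaryGroup.LocalRing L v))]
  exact Matrix.isUnits_det_units _

/-- **`τ_v`'s argument `−χ_g(u)·det g⁻¹` is a unit** for `G`-regular `γ_H`. [cite: Rogawski1990, §4.9 p. 55] -/
theorem isUnit_finTauArg_of_isLocalGRegular (hreg : IsLocalGRegular L v a) : IsUnit (finTauArg L v a) := by
  unfold finTauArg
  exact ((isUnit_eval_finCharpolyTwo_of_isLocalGRegular L v a hreg).neg).mul (Matrix.isUnits_det_units _)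

omit [IsCMField L] in
/-- `μ_v` at a unit is a value of the semi-local component in `ℂˣ`, hence non-zero. [cite: Rogawski1990, §4.9 p. 55] -/
theorem finHeckeValue_ne_zero_of_isUnit (μ : HeckeCharacter L) {x : UnitaryGroup.LocalRing L v} (hx : IsUnit x) :
    finHeckeValue L v μ x ≠ 0 := by
  rw [finHeckeValue_of_isUnit L v μ hx]
  exact Units.ne_zero _

/-- **`τ_v(γ_H) ≠ 0`** for `G`-regular `γ_H` («`|τ| = 1`»). [cite: Rogawski1990, §4.9 p. 55] -/
theorem finTau_ne_zero_of_isLocalGRegular (μ : HeckeCharacter L) (hreg : IsLocalGRegular L v a) : finTau L v a μ ≠ 0 :=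
  mul_ne_zero (finHeckeValue_ne_zero_of_isUnit L v μ (isUnit_finGammaTwo L v a))
    (inv_ne_zero (finHeckeValue_ne_zero_of_isUnit L v μ (isUnit_finTauArg_of_isLocalGRegular L v a hreg)))

/-- **`D_{G∕H,v}(γ_H) ≠ 0`** for `G`-regular `γ_H` (`‖χ_g(u)_w‖_w > 0` at every `w ∣ v`). [cite: Rogawski1990, §4.9 p. 55] -/
theorem finWeylRatio_ne_zero_of_isLocalGRegular (hreg : IsLocalGRegular L v a) : finWeylRatio L v a ≠ 0 := by
  unfold finWeylRatio
  rw [Real.sqrt_ne_zero']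
  exact Finset.prod_pos fun w _ => norm_pos_iff.2 ((Pi.isUnit_iff.1 (isUnit_eval_finCharpolyTwo_of_isLocalGRegular L v a hreg) w).ne_zero)

/-! ## §3 `P_v` on a matching pair: `tr P_v = χ_g(u)`, so `P_v ≠ 0` and `κ_v = ±1` -/

/-- **`P_v = c · χ_g(u) E₂₂ · c⁻¹`** when `γ′ = c ι_v(γ_H) c⁻¹` in `GL₃(E)` (Cayley–Hamilton on the `g`-block of the pattern ★ `coe_endoGL_eq`; the algebra of ★
`archEigenlineProjector_eq_vecMulVec_of_isArchNormPair` over the ring `E`). [cite: Rogawski1990, §4.9 p. 55; §14.6 p. 242] -/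
theorem finEigenlineProjector_eq_of_conj_eq (c : GL (Fin 3) (UnitaryGroup.LocalRing L v))
    (hc : c * ((endoEmbLocal L v a).val : GL (Fin 3) (UnitaryGroup.LocalRing L v)) * c⁻¹ = (b.val : GL (Fin 3) (UnitaryGroup.LocalRing L v))) :
    finEigenlineProjector L v H' a b =
      (c.val : Matrix (Fin 3) (Fin 3) (UnitaryGroup.LocalRing L v)) *
        vecMulVec (Pi.single 1 ((finCharpolyTwo L v a).eval (finGammaTwo L v a))) (Pi.single 1 (1 : UnitaryGroup.LocalRing L v)) *
        ((c⁻¹).val : Matrix (Fin 3) (Fin 3) (UnitaryGroup.LocalRing L v)) := by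
  have hmat : (b.val.val : Matrix (Fin 3) (Fin 3) (UnitaryGroup.LocalRing L v)) =
      (c.val : Matrix (Fin 3) (Fin 3) (UnitaryGroup.LocalRing L v)) * ((endoEmbLocal L v a).val.val : Matrix (Fin 3) (Fin 3) (UnitaryGroup.LocalRing L v)) *
        ((c⁻¹).val : Matrix (Fin 3) (Fin 3) (UnitaryGroup.LocalRing L v)) := by
    rw [← Units.val_mul, ← Units.val_mul, hc]
  have h1 : ((c⁻¹).val : Matrix (Fin 3) (Fin 3) (UnitaryGroup.LocalRing L v)) *
      (c.val : Matrix (Fin 3) (Fin 3) (UnitaryGroup.LocalRing L v)) = 1 := by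
    rw [← Units.val_mul, inv_mul_cancel, Units.val_one]
  have h2 : (c.val : Matrix (Fin 3) (Fin 3) (UnitaryGroup.LocalRing L v)) *
      ((c⁻¹).val : Matrix (Fin 3) (Fin 3) (UnitaryGroup.LocalRing L v)) = 1 := by
    rw [← Units.val_mul, mul_inv_cancel, Units.val_one]
  set g := (a.1.val.val : Matrix (Fin 2) (Fin 2) (UnitaryGroup.LocalRing L v)) with hg
  set U := (a.2.val.val : Matrix (Fin 1) (Fin 1) (UnitaryGroup.LocalRing L v)) with hU
  have hι : ((endoEmbLocal L v a).val.val : Matrix (Fin 3) (Fin 3) (UnitaryGroup.LocalRing L v)) = !![g 0 0, 0, g 0 1; 0, U 0 0, 0; g 1 0, 0, g 1 1] := by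
    rw [coe_endoEmbLocal, coe_endoGL_eq]
  have hs : (finCharpolyTwo L v a).eval (finGammaTwo L v a) = U 0 0 * U 0 0 - g.trace * U 0 0 + g.det :=
    eval_finCharpolyTwo_finGammaTwo L v a
  rw [hs]
  dsimp only [finEigenlineProjector]
  rw [← hg, hmat, hι, conj_mul_sq_sub_smul_add_smul_one _ _ _ _ _ h1 h2, endoPattern_sq_sub_trace_smul_add_det_smul_one g (U 0 0)]

/-- **`tr P_v(γ_H, γ′) = χ_g(u)`** on a matching pair. [cite: Rogawski1990, §4.9 p. 55] -/
theorem trace_finEigenlineProjector_of_isLocalNormPair (hp : IsLocalNormPair L H' v a b) :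
    (finEigenlineProjector L v H' a b).trace = (finCharpolyTwo L v a).eval (finGammaTwo L v a) := by
  rw [isLocalNormPair_iff] at hp
  obtain ⟨c, hc⟩ := isConj_iff.1 hp
  have h1 : ((c⁻¹).val : Matrix (Fin 3) (Fin 3) (UnitaryGroup.LocalRing L v)) *
      (c.val : Matrix (Fin 3) (Fin 3) (UnitaryGroup.LocalRing L v)) = 1 := by
    rw [← Units.val_mul, inv_mul_cancel, Units.val_one]
  rw [finEigenlineProjector_eq_of_conj_eq L v H' a b c hc, trace_conj_eq _ _ _ h1, trace_vecMulVec, single_dotProduct, Pi.single_eq_same, mul_one]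

/-- **`P_v ≠ 0` on a matching `G`-regular pair** (its trace `χ_g(u)` is a unit of the non-trivial ring `E`). [cite: Rogawski1990, §4.9 p. 55] -/
theorem finEigenlineProjector_ne_zero (hp : IsLocalNormPair L H' v a b) (hreg : IsLocalGRegular L v a) :
    finEigenlineProjector L v H' a b ≠ 0 := by
  haveI := nontrivial_localRing L v
  intro h0
  have ht := trace_finEigenlineProjector_of_isLocalNormPair L v H' a b hp
  rw [h0, Matrix.trace_zero] at ht
  exact (isUnit_eval_finCharpolyTwo_of_isLocalGRegular L v a hreg).ne_zero ht.symm

open scoped Classical in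
/-- **`κ_v(γ_H, γ′) = ±1 ≠ 0` on a matching `G`-regular pair** («`κ(γ, ψ_v(i(γ)))` is equal to `±1`»). [cite: Rogawski1990, §14.6 p. 242; §4.3 p. 43] -/
theorem finKappaAt_ne_zero (hp : IsLocalNormPair L H' v a b) (hreg : IsLocalGRegular L v a) : finKappaAt L v H' a b ≠ 0 := by
  have hP := finEigenlineProjector_ne_zero L v H' a b hp hreg
  unfold finKappaAt
  rw [if_neg hP]
  split_ifs <;> decide

/-! ## §4 Assembly: `Δ‴_v` is non-degenerate -/

open scoped Classical in
/-- **N2f: PRINT'S FINITE FACTOR `Δ‴_v` IS NON-DEGENERATE** — `Δ‴_v(γ_H, γ′) ≠ 0` whenever `ι_v(γ_H) ↔ γ′` and `γ_H` is `G`-regular, for every `H′`, every Hecke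
character `μ` and every finite place `v` (the ★ `IsLocalNondegenerate` clause of #72 at `Δ_v := finExplicitTransferFactor L v H′ μ hl hr`).
[cite: Rogawski1990, §4.9 pp. 54–55; §14.6 p. 242] [cite: LanglandsShelstad1987, §1] -/
theorem isLocalNondegenerate_finExplicitTransferFactor (μ : HeckeCharacter L)
    (hl : ∀ (a : (UnitaryGroup.cmDatum L 2 (Matrix.of fun i j : Fin 2 => if i.val + j.val + 1 = 2 then (1 : L) else 0)).Local v ×
      (UnitaryGroup.cmDatum L 1 (Matrix.of fun i j : Fin 1 => if i.val + j.val + 1 = 1 then (1 : L) else 0)).Local v)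
      (b : (UnitaryGroup.cmDatum L 3 H').Local v)
      (x : (UnitaryGroup.cmDatum L 2 (Matrix.of fun i j : Fin 2 => if i.val + j.val + 1 = 2 then (1 : L) else 0)).Local v ×
      (UnitaryGroup.cmDatum L 1 (Matrix.of fun i j : Fin 1 => if i.val + j.val + 1 = 1 then (1 : L) else 0)).Local v),
      finExplicitDelta L v H' (x * a * x⁻¹) μ b = finExplicitDelta L v H' a μ b)
    (hr : ∀ (a : (UnitaryGroup.cmDatum L 2 (Matrix.of fun i j : Fin 2 => if i.val + j.val + 1 = 2 then (1 : L) else 0)).Local v ×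
      (UnitaryGroup.cmDatum L 1 (Matrix.of fun i j : Fin 1 => if i.val + j.val + 1 = 1 then (1 : L) else 0)).Local v)
      (b y : (UnitaryGroup.cmDatum L 3 H').Local v),
      finExplicitDelta L v H' a μ (y * b * y⁻¹) = finExplicitDelta L v H' a μ b) :
    IsLocalNondegenerate L H' v (finExplicitTransferFactor L v H' μ hl hr) := by
  rw [isLocalNondegenerate_iff]
  intro γH γ hp hreg
  rw [finExplicitTransferFactor_Δ, finExplicitDelta_of_isLocalNormPair L v H' γH μ hp]
  refine mul_ne_zero (mul_ne_zero (finTau_ne_zero_of_isLocalGRegular L v γH μ hreg)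
    (Complex.ofReal_ne_zero.2 (finWeylRatio_ne_zero_of_isLocalGRegular L v γH hreg))) ?_
  rw [Int.cast_ne_zero]
  exact finKappaAt_ne_zero L v H' γH γ hp hreg

end Place

section Collection

variable (L : Type) [Field L] [NumberField L] [IsCMField L] (H' : Matrix (Fin 3) (Fin 3) L) (μ : HeckeCharacter L)

open scoped Classical in
/-- **Every member of the explicit finite collection `(Δ‴_v)_v` is non-degenerate** — the `∀ v, IsLocalNondegenerate L H′ v (Δ v)` clause of ★
`GlobalTransferWithCartanKappaFormula` at `Δ := finExplicitCollection L H′ μ hl hr`. [cite: Rogawski1990, §4.9 pp. 54–55; §14.6 p. 242] -/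
theorem isLocalNondegenerate_finExplicitCollection
    (hl : ∀ (v : HeightOneSpectrum (𝓞 ↥(maximalRealSubfield L)))
      (a : (UnitaryGroup.cmDatum L 2 (Matrix.of fun i j : Fin 2 => if i.val + j.val + 1 = 2 then (1 : L) else 0)).Local v ×
      (UnitaryGroup.cmDatum L 1 (Matrix.of fun i j : Fin 1 => if i.val + j.val + 1 = 1 then (1 : L) else 0)).Local v)
      (b : (UnitaryGroup.cmDatum L 3 H').Local v)
      (x : (UnitaryGroup.cmDatum L 2 (Matrix.of fun i j : Fin 2 => if i.val + j.val + 1 = 2 then (1 : L) else 0)).Local v ×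
      (UnitaryGroup.cmDatum L 1 (Matrix.of fun i j : Fin 1 => if i.val + j.val + 1 = 1 then (1 : L) else 0)).Local v),
      finExplicitDelta L v H' (x * a * x⁻¹) μ b = finExplicitDelta L v H' a μ b)
    (hr : ∀ (v : HeightOneSpectrum (𝓞 ↥(maximalRealSubfield L)))
      (a : (UnitaryGroup.cmDatum L 2 (Matrix.of fun i j : Fin 2 => if i.val + j.val + 1 = 2 then (1 : L) else 0)).Local v ×
      (UnitaryGroup.cmDatum L 1 (Matrix.of fun i j : Fin 1 => if i.val + j.val + 1 = 1 then (1 : L) else 0)).Local v)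
      (b y : (UnitaryGroup.cmDatum L 3 H').Local v),
      finExplicitDelta L v H' a μ (y * b * y⁻¹) = finExplicitDelta L v H' a μ b)
    (v : HeightOneSpectrum (𝓞 ↥(maximalRealSubfield L))) :
    IsLocalNondegenerate L H' v (finExplicitCollection L H' μ hl hr v) :=
  isLocalNondegenerate_finExplicitTransferFactor L v H' μ (hl v) (hr v)

end Collection

end Literature.NumberTheory.Rogawski1990

end
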